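import Literature.AlgebraicGeometry.Motives.HodgeLieWeightOneSl2CenterStructure
import Literature.AlgebraicGeometry.Motives.HodgeLieReductiveAnyWeight
import Literature.AlgebraicGeometry.Motives.HodgeLieRankLowerBound
import Literature.Algebra.Lie.SemisimpleDimensionThreeSimple
import HarnessLib

/-!
# Block idempotents for a Hodge Lie algebra with three-dimensional derived algebra: `p D = D` on `[Lie Hg, Lie Hg]`

Family `hodge`, layer `Literature/AlgebraicGeometry/Motives` (abstract polarizable `ℚ`-Hodge structures; no geometry).
THEOREMS ONLY (no definition, no named fact; D-0026).  Cell `pub-hodgecm2` (COR-CM), seat `b27`, count-neutral own lane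
MT-RANK-SIX-CMPART (sequel of MT-RANK-SIX-ISOGENY): the abstract input closing the gap «`e^* D = D` for `D ∈ [Lie Hg, Lie Hg]`»
left in `Summits/HodgeConjecture/CorCM/MumfordTateRankSixCMPart`.

SETTING. `H` a polarizable `ℚ`-Hodge structure on `V` with Hodge Lie algebra `𝔥 = Lie Hg(H)`, centre `𝔷 = 𝔥 ∩ End_Hdg(V)`
and derived algebra `𝔡 = span_ℚ {XY − YX | X, Y ∈ 𝔥}`; `𝔥 = 𝔷 ⊕ 𝔡` with `𝔡` semisimple in every weight
(`AnyWeight.hodgeLie_center_sup_derived_eq`, `AnyWeight.isSemisimple_of_eq_hodgeLie_derived`).  A **block idempotent** is a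
Hodge endomorphism `p = p²` with `(1 − p)𝔥 ⊆ 𝔥` and `𝔷 p = 0` — exactly the shape exported for `p = e^*` by
`CorCM/MumfordTateRankSixCenter` / `…Splitting` (`e` the central idempotent of `End⁰(X)` cutting out the `𝔰𝔩₂`-part).

RESULTS (namespace `HodgeStructure`):
* `derived_ideal_eq_bot_or_eq` — when `dim 𝔡 = 3`, a subspace `𝔨 ⊆ 𝔡` with `[𝔡, 𝔨] ⊆ 𝔨` is `0` or `𝔡` (`𝔡` is a SIMPLE Lie
  algebra: semisimple of dimension `3`, `SemisimpleSmallDimension.isSimple_of_finrank_eq_three`), any weight.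
* `derived_mul_idempotent_dichotomy` — for a block idempotent `p` and `dim 𝔡 = 3` (any weight): EITHER `p D = D = D p` for
  every `D ∈ 𝔡`, OR `𝔥 p = 0` (the ideal `{D ∈ 𝔡 | p D = 0}` of `𝔡` is `0` or `𝔡`).
* `eq_zero_of_forall_hodgeLie_mul_eq_zero` — in weight `1`, `𝔥 p = 0` forces `p = 0` (the Hodge operator `2Θ − 1 ∈ 𝔥_ℂ` is
  invertible: its eigenvalues `2p − 1` are odd).
* **`mul_eq_self_of_mem_derived_of_block`** — weight `1`, `dim 𝔡 = 3`, `p ≠ 0` a block idempotent ⟹ `p D = D = D p` on `𝔡`;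
  **`sub_mul_mem_center_of_block`** — `X − p X ∈ 𝔷` for every `X ∈ 𝔥`; `map_hodgeLie_eq_center_of_block` —
  `(1 − p)𝔥 = 𝔷`; `mul_eq_self_iff_mem_derived_of_block` — for `X ∈ 𝔥`: `p X = X ↔ X ∈ 𝔡` (so `p𝔥 = 𝔡`: the Hodge Lie
  algebra acts on `pV` through `𝔡 ≅ 𝔰𝔩₂` and on `(1 − p)V` through `𝔷`).

Geometric reading (`CorCM/MumfordTateRankSixCMRank`): for a complex abelian variety `X` with `dim [Lie Hg(H¹X), Lie Hg(H¹X)] = 3`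
(e.g. not of CM type with `dim MT(H¹X) ≤ 6`) and its splitting `X ∼ B^{m+1} × Z` (Moonen–Zarhin 1999 §2: `Hg = SL₂ · torus`),
the CM part `Z` has `dim Lie Hg(H¹Z) = dim 𝔷 = dim MT(H¹X) − 4`.

## References

* [MoonenZarhin1999LowDim] B. Moonen, Yu. Zarhin, *Hodge classes on abelian varieties of low dimension*, Math. Ann. 315
  (1999), §2 and §3 (3.8).
* [Deligne1982HodgeCycles] P. Deligne, *Hodge cycles on abelian varieties*, LNM 900 (1982), I §3 (3.1–3.6).
* [Humphreys1972] J. E. Humphreys, *Introduction to Lie Algebras and Representation Theory*, GTM 9, §5.2, §19.1.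
* [Huybrechts2016K3] D. Huybrechts, *Lectures on K3 Surfaces* (2016), §3.3.4 (p. 66).
-/

noncomputable section

open scoped TensorProduct

namespace Literature.AlgebraicGeometry.Motives

namespace HodgeStructure

universe u

variable {V : Type u} [AddCommGroup V] [Module ℚ V] [Module.Finite ℚ V] [HodgeTensorFacts.{u, u}] {n : ℤ}

/-! ## §1 Ideals of a three-dimensional derived algebra -/

/-- **An ideal of a three-dimensional `𝔡 = [Lie Hg, Lie Hg]` is `0` or `𝔡`** (span language: `𝔨 ⊆ 𝔡` a subspace with
`D A − A D ∈ 𝔨` for `D ∈ 𝔡`, `A ∈ 𝔨`).  `𝔡` is semisimple in every weight and a semisimple Lie algebra of dimension `3` is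
simple (`LieAlgebra.IsSimple`). [cite: Deligne1982HodgeCycles, I §3 Prop. 3.6] [cite: Humphreys1972, §5.2] -/
theorem derived_ideal_eq_bot_or_eq (H : HodgeStructure V n) (ψ : H.Polarization)
    (h3 : Module.finrank ℚ ↥(Submodule.span ℚ {B | ∃ X ∈ H.hodgeLie, ∃ Y ∈ H.hodgeLie, X * Y - Y * X = B}) = 3)
    {𝔨 : Submodule ℚ (Module.End ℚ V)}
    (h𝔨 : 𝔨 ≤ Submodule.span ℚ {B | ∃ X ∈ H.hodgeLie, ∃ Y ∈ H.hodgeLie, X * Y - Y * X = B})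
    (hideal : ∀ D ∈ Submodule.span ℚ {B | ∃ X ∈ H.hodgeLie, ∃ Y ∈ H.hodgeLie, X * Y - Y * X = B}, ∀ A ∈ 𝔨,
      D * A - A * D ∈ 𝔨) :
    𝔨 = ⊥ ∨ 𝔨 = Submodule.span ℚ {B | ∃ X ∈ H.hodgeLie, ∃ Y ∈ H.hodgeLie, X * Y - Y * X = B} := by
  letI : LieRing (Module.End ℚ V) := LieRing.ofAssociativeRing
  obtain ⟨𝔏, h𝔏⟩ := exists_lieSubalgebra_eq_hodgeLie_derived H
  haveI := AnyWeight.isSemisimple_of_eq_hodgeLie_derived H ψ 𝔏 h𝔏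
  haveI : Module.Finite ℚ 𝔏 := Module.Finite.of_injective 𝔏.toSubmodule.subtype Subtype.val_injective
  have hfin : Module.finrank ℚ 𝔏 = 3 := by
    have e : Module.finrank ℚ 𝔏 = Module.finrank ℚ 𝔏.toSubmodule := rfl
    rw [e, h𝔏, h3]
  haveI : LieAlgebra.IsSimple ℚ 𝔏 :=
    Literature.Algebra.Lie.SemisimpleSmallDimension.isSimple_of_finrank_eq_three hfin
  have hmem : ∀ D, D ∈ 𝔏 ↔ D ∈ Submodule.span ℚ {B | ∃ X ∈ H.hodgeLie, ∃ Y ∈ H.hodgeLie, X * Y - Y * X = B} :=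
    fun D => by rw [← LieSubalgebra.mem_toSubmodule, h𝔏]
  -- the Lie ideal of `𝔏` with carrier `𝔨`
  let K𝔏 : Submodule ℚ 𝔏 := 𝔨.comap ((𝔏.incl : 𝔏 →ₗ⁅ℚ⁆ Module.End ℚ V) : 𝔏 →ₗ[ℚ] Module.End ℚ V)
  have hK : ∀ a : 𝔏, a ∈ K𝔏 ↔ (a : Module.End ℚ V) ∈ 𝔨 := fun a => Iff.rfl
  let I : LieIdeal ℚ 𝔏 :=
    { K𝔏 with
      lie_mem := fun {x a} ha => by
        have ha' : (a : Module.End ℚ V) ∈ 𝔨 := ha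
        change ((⁅x, a⁆ : 𝔏) : Module.End ℚ V) ∈ 𝔨
        rw [LieSubalgebra.coe_bracket, LieRing.of_associative_ring_bracket]
        exact hideal _ ((hmem _).1 x.2) _ ha' }
  have hI : ∀ a : 𝔏, a ∈ I ↔ (a : Module.End ℚ V) ∈ 𝔨 := fun a => Iff.rfl
  rcases LieAlgebra.IsSimple.eq_bot_or_eq_top I with hbot | htop
  · left
    rw [eq_bot_iff]
    intro A hA
    have hA𝔏 : A ∈ 𝔏 := (hmem A).2 (h𝔨 hA)
    have hAI : (⟨A, hA𝔏⟩ : 𝔏) ∈ I := (hI _).2 hA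
    rw [hbot, LieSubmodule.mem_bot] at hAI
    rw [Submodule.mem_bot]
    exact congrArg Subtype.val hAI
  · right
    refine le_antisymm h𝔨 fun D hD => ?_
    have hD𝔏 : D ∈ 𝔏 := (hmem D).2 hD
    have hDI : (⟨D, hD𝔏⟩ : 𝔏) ∈ I := by rw [htop]; exact LieSubmodule.mem_top _
    exact (hI _).1 hDI

/-! ## §2 The dichotomy for a block idempotent (any weight) -/

/-- **Dichotomy for a block idempotent.**  Let `p ∈ End_Hdg(V)` be an idempotent with `X − p X ∈ 𝔥` for every `X ∈ 𝔥` and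
`Z p = 0` for every `Z ∈ 𝔷 = 𝔥 ∩ End_Hdg(V)`, and let `dim 𝔡 = 3`.  Then EITHER `p D = D = D p` for every `D ∈ 𝔡` (the Hodge
Lie algebra acts on `(1 − p)V` through its centre), OR `X p = 0 = p X` for every `X ∈ 𝔥` (it acts trivially on `pV`).  Proof:
`(1 − p)𝔡 ⊆ 𝔡` (as `(1−p)[X,Y] = [(1−p)X, (1−p)Y]`), so `{D ∈ 𝔡 | pD = 0}` is an ideal of the simple `𝔡`.
[cite: MoonenZarhin1999LowDim, §2] [cite: Deligne1982HodgeCycles, I §3 Prop. 3.6] [cite: Humphreys1972, §5.2] -/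
theorem derived_mul_idempotent_dichotomy (H : HodgeStructure V n) (ψ : H.Polarization)
    (h3 : Module.finrank ℚ ↥(Submodule.span ℚ {B | ∃ X ∈ H.hodgeLie, ∃ Y ∈ H.hodgeLie, X * Y - Y * X = B}) = 3)
    {p : Module.End ℚ V} (hpA : p ∈ H.endAlg) (hpp : p * p = p)
    (hblk : ∀ X ∈ H.hodgeLie, X - p * X ∈ H.hodgeLie)
    (hZp : ∀ Z ∈ H.hodgeLie ⊓ Subalgebra.toSubmodule H.endAlg, Z * p = 0) :
    (∀ D ∈ Submodule.span ℚ {B | ∃ X ∈ H.hodgeLie, ∃ Y ∈ H.hodgeLie, X * Y - Y * X = B}, p * D = D ∧ D * p = D) ∨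
      (∀ X ∈ H.hodgeLie, X * p = 0 ∧ p * X = 0) := by
  set 𝔡 := Submodule.span ℚ {B | ∃ X ∈ H.hodgeLie, ∃ Y ∈ H.hodgeLie, X * Y - Y * X = B} with h𝔡def
  have hbr : ∀ X ∈ H.hodgeLie, ∀ Y ∈ H.hodgeLie, X * Y - Y * X ∈ H.hodgeLie := fun X hX Y hY =>
    H.commutator_mem_hodgeLie hX hY
  have h𝔡le : 𝔡 ≤ H.hodgeLie := Literature.Algebra.Lie.TraceSeparating.derived_le H.hodgeLie hbr
  have hpc : ∀ X ∈ H.hodgeLie, X * p = p * X := fun X hX => H.commute_of_mem_hodgeLie hX ⟨p, hpA⟩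
  -- `q = 1 - p`
  set q : Module.End ℚ V := 1 - p with hqdef
  have hqX : ∀ X, q * X = X - p * X := fun X => by rw [hqdef, sub_mul, one_mul]
  have hqq : q * q = q := by rw [hqdef, sub_mul, one_mul, mul_sub, mul_one, hpp, sub_self, sub_zero]
  have hpq : p * q = 0 := by rw [hqdef, mul_sub, mul_one, hpp, sub_self]
  have hqc : ∀ X ∈ H.hodgeLie, X * q = q * X := fun X hX => by
    rw [hqdef, mul_sub, sub_mul, mul_one, one_mul, hpc X hX]
  have hqmul : ∀ X ∈ H.hodgeLie, ∀ Y : Module.End ℚ V, (q * X) * (q * Y) = q * (X * Y) := by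
    intro X hX Y
    calc (q * X) * (q * Y) = q * (X * q) * Y := by noncomm_ring
      _ = q * (q * X) * Y := by rw [hqc X hX]
      _ = (q * q) * (X * Y) := by noncomm_ring
      _ = q * (X * Y) := by rw [hqq]
  -- step 1: `q 𝔡 ⊆ 𝔡`
  have hq𝔡 : ∀ D ∈ 𝔡, q * D ∈ 𝔡 := by
    intro D hD
    induction hD using Submodule.span_induction with
    | mem B hB =>
      obtain ⟨X, hX, Y, hY, rfl⟩ := hB
      have hqXm : q * X ∈ H.hodgeLie := by rw [hqX]; exact hblk X hX
      have hqYm : q * Y ∈ H.hodgeLie := by rw [hqX]; exact hblk Y hY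
      have : q * (X * Y - Y * X) = (q * X) * (q * Y) - (q * Y) * (q * X) := by
        rw [mul_sub, hqmul X hX, hqmul Y hY]
      rw [this]
      exact Literature.Algebra.Lie.TraceSeparating.commutator_mem_derived H.hodgeLie hqXm hqYm
    | zero => rw [mul_zero]; exact Submodule.zero_mem _
    | add D D' _ _ hD hD' => rw [mul_add]; exact Submodule.add_mem _ hD hD'
    | smul c D _ hD => rw [mul_smul_comm]; exact Submodule.smul_mem _ c hD
  -- step 2: the ideal `𝔨 = {D ∈ 𝔡 | p D = 0}`
  let 𝔨 : Submodule ℚ (Module.End ℚ V) := 𝔡 ⊓ LinearMap.ker (LinearMap.mulLeft ℚ p)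
  have h𝔨mem : ∀ A, A ∈ 𝔨 ↔ A ∈ 𝔡 ∧ p * A = 0 := fun A => by
    change A ∈ 𝔡 ⊓ LinearMap.ker (LinearMap.mulLeft ℚ p) ↔ _
    rw [Submodule.mem_inf, LinearMap.mem_ker, LinearMap.mulLeft_apply]
  have h𝔨le : 𝔨 ≤ 𝔡 := fun A hA => ((h𝔨mem A).1 hA).1
  have hideal : ∀ D ∈ 𝔡, ∀ A ∈ 𝔨, D * A - A * D ∈ 𝔨 := by
    intro D hD A hA
    obtain ⟨hA𝔡, hpA0⟩ := (h𝔨mem A).1 hA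
    refine (h𝔨mem _).2 ⟨Literature.Algebra.Lie.TraceSeparating.commutator_mem_derived H.hodgeLie (h𝔡le hD)
      (h𝔡le hA𝔡), ?_⟩
    rw [mul_sub, ← mul_assoc, ← hpc D (h𝔡le hD), mul_assoc, hpA0, mul_zero, ← mul_assoc, hpA0, zero_mul, sub_zero]
  -- step 3: simplicity
  rcases derived_ideal_eq_bot_or_eq H ψ h3 h𝔨le hideal with hbot | htop
  · left
    intro D hD
    have hqD : q * D ∈ 𝔨 := (h𝔨mem _).2 ⟨hq𝔡 D hD, by rw [← mul_assoc, hpq, zero_mul]⟩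
    rw [hbot, Submodule.mem_bot, hqX, sub_eq_zero] at hqD
    exact ⟨hqD.symm, by rw [hpc D (h𝔡le hD)]; exact hqD.symm⟩
  · right
    intro X hX
    have hX' := hX
    rw [← AnyWeight.hodgeLie_center_sup_derived_eq H ψ] at hX'
    obtain ⟨Z, hZ, D, hD, rfl⟩ := Submodule.mem_sup.1 hX'
    have hpD : p * D = 0 := by
      have hD𝔨 : D ∈ 𝔨 := by rw [htop]; exact hD
      exact ((h𝔨mem D).1 hD𝔨).2
    have hZp' : Z * p = 0 := hZp Z hZ
    have h1 : (Z + D) * p = 0 := by rw [add_mul, hZp', hpc D (h𝔡le hD), hpD, add_zero]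
    exact ⟨h1, by rw [← hpc _ hX]; exact h1⟩

/-! ## §3 Weight one: the Hodge Lie algebra kills nothing -/

/-- **In weight `1` the Hodge Lie algebra does not act trivially on a non-zero direct summand**: if `X p = 0` for every
`X ∈ 𝔥 = Lie Hg(H)` then `p = 0`.  The Hodge operator `Θ' = 2Θ − n ∈ 𝔥_ℂ` (`two_smul_gradingEnd_sub_mem_hodgeLieC`) acts on a
graded basis vector of degree `d` by the ODD integer `2d − 1 ≠ 0`, so `Θ'` is invertible and `Θ' p_ℂ = 0` gives `p = 0`.
[cite: Deligne1982HodgeCycles, I §3 (3.1–3.4)] [cite: Huybrechts2016K3, §3.3.4 (p. 66)] -/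
theorem eq_zero_of_forall_hodgeLie_mul_eq_zero (H : HodgeStructure V n) (hn : n = 1) {p : Module.End ℚ V}
    (hp : ∀ X ∈ H.hodgeLie, X * p = 0) : p = 0 := by
  classical
  obtain ⟨S, deg, e, hF, hFc⟩ := exists_basis_F_eq_span H
  haveI : Fintype S := FiniteDimensional.fintypeBasisIndex e
  -- every element of `𝔥_ℂ` kills `p_ℂ`
  have hC : ∀ Y ∈ H.hodgeLieC, Y * p.baseChange ℂ = 0 := by
    intro Y hY
    induction hY using Submodule.span_induction with
    | mem Z hZ =>
      obtain ⟨X, hX, rfl⟩ := hZ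
      rw [Module.End.mul_eq_comp, ← LinearMap.baseChange_comp, ← Module.End.mul_eq_comp, hp X hX,
        LinearMap.baseChange_zero]
    | zero => exact zero_mul _
    | add Z Z' _ _ hZ hZ' => rw [add_mul, hZ, hZ', add_zero]
    | smul c Z _ hZ => rw [smul_mul_assoc, hZ, smul_zero]
  have h1 : ((2 : ℂ) • gradingEnd e deg - (n : ℂ) • (1 : Module.End ℂ (ℂ ⊗[ℚ] V))) * p.baseChange ℂ = 0 :=
    hC _ (two_smul_gradingEnd_sub_mem_hodgeLieC H e hF hFc)
  -- `Θ'` is invertible: eigenvalues `2 deg σ - 1 ≠ 0`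
  have hne : ∀ σ, ((2 * deg σ - n : ℤ) : ℂ) ≠ 0 := fun σ => by
    have : (2 * deg σ - n : ℤ) ≠ 0 := by omega
    exact_mod_cast this
  have hΘe : ∀ σ, ((2 : ℂ) • gradingEnd e deg - (n : ℂ) • (1 : Module.End ℂ (ℂ ⊗[ℚ] V))) (e σ) =
      ((2 * deg σ - n : ℤ) : ℂ) • e σ := by
    intro σ
    rw [LinearMap.sub_apply, LinearMap.smul_apply, LinearMap.smul_apply, gradingEnd_apply_basis,
      Module.End.one_apply, smul_smul, ← sub_smul]
    congr 1
    push_cast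
    ring
  let Θinv : Module.End ℂ (ℂ ⊗[ℚ] V) := e.constr ℂ fun σ => (((2 * deg σ - n : ℤ) : ℂ))⁻¹ • e σ
  have hinv : Θinv * ((2 : ℂ) • gradingEnd e deg - (n : ℂ) • (1 : Module.End ℂ (ℂ ⊗[ℚ] V))) = 1 := by
    refine e.ext fun σ => ?_
    rw [Module.End.mul_apply, hΘe, map_smul, Module.Basis.constr_basis, smul_smul, mul_inv_cancel₀ (hne σ), one_smul,
      Module.End.one_apply]
  have hpC : p.baseChange ℂ = 0 := by
    rw [← one_mul (p.baseChange ℂ), ← hinv, mul_assoc, h1, mul_zero]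
  exact eq_zero_of_baseChange_eq_zero hpC

/-! ## §4 Weight one, `dim 𝔡 = 3`: `p D = D` on the derived algebra and `(1 − p)𝔥 = 𝔷` -/

/-- **`p D = D = D p` for every `D ∈ [Lie Hg, Lie Hg]`** — `H` polarizable of weight `1` with `dim [𝔥, 𝔥] = 3`, `p ≠ 0` a Hodge
idempotent with `X − pX ∈ 𝔥` (`X ∈ 𝔥`) and `𝔷 p = 0`: the derived algebra `𝔡 ≅ 𝔰𝔩₂` lives on the block `pV`.  (The alternative
`𝔥 p = 0` of `derived_mul_idempotent_dichotomy` is excluded by `eq_zero_of_forall_hodgeLie_mul_eq_zero`.)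
[cite: MoonenZarhin1999LowDim, §2] [cite: Deligne1982HodgeCycles, I §3 (3.4–3.6)] -/
theorem mul_eq_self_of_mem_derived_of_block (H : HodgeStructure V n) (ψ : H.Polarization) (hn : n = 1)
    (h3 : Module.finrank ℚ ↥(Submodule.span ℚ {B | ∃ X ∈ H.hodgeLie, ∃ Y ∈ H.hodgeLie, X * Y - Y * X = B}) = 3)
    {p : Module.End ℚ V} (hpA : p ∈ H.endAlg) (hpp : p * p = p) (hp0 : p ≠ 0)
    (hblk : ∀ X ∈ H.hodgeLie, X - p * X ∈ H.hodgeLie)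
    (hZp : ∀ Z ∈ H.hodgeLie ⊓ Subalgebra.toSubmodule H.endAlg, Z * p = 0) :
    ∀ D ∈ Submodule.span ℚ {B | ∃ X ∈ H.hodgeLie, ∃ Y ∈ H.hodgeLie, X * Y - Y * X = B}, p * D = D ∧ D * p = D := by
  rcases derived_mul_idempotent_dichotomy H ψ h3 hpA hpp hblk hZp with h | h
  · exact h
  · exact absurd (eq_zero_of_forall_hodgeLie_mul_eq_zero H hn fun X hX => (h X hX).1) hp0

/-- **`X − p X ∈ 𝔷` for every `X ∈ 𝔥`** (same hypotheses): writing `X = Z + D` with `Z ∈ 𝔷`, `D ∈ 𝔡`, one has `pZ = 0` and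
`pD = D`, so `(1 − p)X = Z`.  In words: the Hodge Lie algebra acts on the block `(1 − p)V` through its CENTRE only.
[cite: MoonenZarhin1999LowDim, §2] [cite: Deligne1982HodgeCycles, I §3 (3.4–3.6)] -/
theorem sub_mul_mem_center_of_block (H : HodgeStructure V n) (ψ : H.Polarization) (hn : n = 1)
    (h3 : Module.finrank ℚ ↥(Submodule.span ℚ {B | ∃ X ∈ H.hodgeLie, ∃ Y ∈ H.hodgeLie, X * Y - Y * X = B}) = 3)
    {p : Module.End ℚ V} (hpA : p ∈ H.endAlg) (hpp : p * p = p) (hp0 : p ≠ 0)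
    (hblk : ∀ X ∈ H.hodgeLie, X - p * X ∈ H.hodgeLie)
    (hZp : ∀ Z ∈ H.hodgeLie ⊓ Subalgebra.toSubmodule H.endAlg, Z * p = 0) :
    ∀ X ∈ H.hodgeLie, X - p * X ∈ H.hodgeLie ⊓ Subalgebra.toSubmodule H.endAlg := by
  intro X hX
  have hX' := hX
  rw [← AnyWeight.hodgeLie_center_sup_derived_eq H ψ] at hX'
  obtain ⟨Z, hZ, D, hD, rfl⟩ := Submodule.mem_sup.1 hX'
  have hpD := (mul_eq_self_of_mem_derived_of_block H ψ hn h3 hpA hpp hp0 hblk hZp D hD).1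
  have hZ𝔥 : Z ∈ H.hodgeLie := (Submodule.mem_inf.1 hZ).1
  have hpZ : p * Z = 0 := by rw [← H.commute_of_mem_hodgeLie hZ𝔥 ⟨p, hpA⟩]; exact hZp Z hZ
  have : Z + D - p * (Z + D) = Z := by rw [mul_add, hpZ, hpD, zero_add, add_sub_cancel_right]
  rw [this]
  exact hZ

/-- **`(1 − p)𝔥 = 𝔷`**: the image of the Hodge Lie algebra under `X ↦ (1 − p)X` IS its centre (`⊆` by
`sub_mul_mem_center_of_block`; `⊇` since `(1 − p)Z = Z` for `Z ∈ 𝔷`). [cite: MoonenZarhin1999LowDim, §2]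
[cite: Deligne1982HodgeCycles, I §3 (3.4–3.6)] -/
theorem map_hodgeLie_eq_center_of_block (H : HodgeStructure V n) (ψ : H.Polarization) (hn : n = 1)
    (h3 : Module.finrank ℚ ↥(Submodule.span ℚ {B | ∃ X ∈ H.hodgeLie, ∃ Y ∈ H.hodgeLie, X * Y - Y * X = B}) = 3)
    {p : Module.End ℚ V} (hpA : p ∈ H.endAlg) (hpp : p * p = p) (hp0 : p ≠ 0)
    (hblk : ∀ X ∈ H.hodgeLie, X - p * X ∈ H.hodgeLie)
    (hZp : ∀ Z ∈ H.hodgeLie ⊓ Subalgebra.toSubmodule H.endAlg, Z * p = 0) :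
    H.hodgeLie.map (LinearMap.mulLeft ℚ (1 - p)) = H.hodgeLie ⊓ Subalgebra.toSubmodule H.endAlg := by
  refine le_antisymm ?_ ?_
  · rintro _ ⟨X, hX, rfl⟩
    rw [LinearMap.mulLeft_apply, sub_mul, one_mul]
    exact sub_mul_mem_center_of_block H ψ hn h3 hpA hpp hp0 hblk hZp X hX
  · intro Z hZ
    have hZ𝔥 : Z ∈ H.hodgeLie := (Submodule.mem_inf.1 hZ).1
    have hpZ : p * Z = 0 := by rw [← H.commute_of_mem_hodgeLie hZ𝔥 ⟨p, hpA⟩]; exact hZp Z hZ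
    refine ⟨Z, hZ𝔥, ?_⟩
    rw [LinearMap.mulLeft_apply, sub_mul, one_mul, hpZ, sub_zero]

/-- **For `X ∈ 𝔥`: `p X = X ↔ X ∈ 𝔡`** (so `p𝔥 = 𝔡 ≅ 𝔰𝔩₂` and `𝔥 = 𝔡 ⊕ 𝔷` is the block decomposition along `p`, `1 − p`).
[cite: MoonenZarhin1999LowDim, §2] [cite: Deligne1982HodgeCycles, I §3 (3.4–3.6)] -/
theorem mul_eq_self_iff_mem_derived_of_block (H : HodgeStructure V n) (ψ : H.Polarization) (hn : n = 1)
    (h3 : Module.finrank ℚ ↥(Submodule.span ℚ {B | ∃ X ∈ H.hodgeLie, ∃ Y ∈ H.hodgeLie, X * Y - Y * X = B}) = 3)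
    {p : Module.End ℚ V} (hpA : p ∈ H.endAlg) (hpp : p * p = p) (hp0 : p ≠ 0)
    (hblk : ∀ X ∈ H.hodgeLie, X - p * X ∈ H.hodgeLie)
    (hZp : ∀ Z ∈ H.hodgeLie ⊓ Subalgebra.toSubmodule H.endAlg, Z * p = 0) {X : Module.End ℚ V} (hX : X ∈ H.hodgeLie) :
    p * X = X ↔ X ∈ Submodule.span ℚ {B | ∃ X ∈ H.hodgeLie, ∃ Y ∈ H.hodgeLie, X * Y - Y * X = B} := by
  constructor
  · intro hpX
    have hX' := hX
    rw [← AnyWeight.hodgeLie_center_sup_derived_eq H ψ] at hX'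
    obtain ⟨Z, hZ, D, hD, hZD⟩ := Submodule.mem_sup.1 hX'
    have hpD := (mul_eq_self_of_mem_derived_of_block H ψ hn h3 hpA hpp hp0 hblk hZp D hD).1
    have hZ𝔥 : Z ∈ H.hodgeLie := (Submodule.mem_inf.1 hZ).1
    have hpZ : p * Z = 0 := by rw [← H.commute_of_mem_hodgeLie hZ𝔥 ⟨p, hpA⟩]; exact hZp Z hZ
    -- `X = pX = pZ + pD = D`
    have hXD : X = D := by rw [← hpX, ← hZD, mul_add, hpZ, hpD, zero_add]
    rw [hXD]
    exact hD
  · intro hD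
    exact (mul_eq_self_of_mem_derived_of_block H ψ hn h3 hpA hpp hp0 hblk hZp X hD).1

end HodgeStructure

end Literature.AlgebraicGeometry.Motives

end
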